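import Summits.NavierStokesRegularity.NavierStokesRegularity.Theorems.QuietScarPocketDoorFrame
import Summits.NavierStokesRegularity.NavierStokesRegularity.Theorems.QuietScarPocketDoorLPocketDefs
import HarnessLib

/-!
# QuietScarPocketDoorLFrame — door S31 «QuietScarPocketDoor», §B «L-POCKET SCHEMA» (texts nsreg-p1 g25 `r29/Sketch31D.lean`
# 8bb56c0a84466268, tree `…QuietScarPocketDoorLPocketDefs`): PLATE (P3) PT-L `frameTransferL_holds : ∀ F L, FrameTransferL L`

The frame transfer of DOOR_L for an ARBITRARY continuous linear constraint `L` on velocity gradients: `PVLPocketRegularity L →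
TargetLPocket L`.  PT (`frameTransferS31_of_annularPressure`, LEAD ns-s30-p1 g0, `…QuietScarPocketDoorFrame`) VERBATIM — parabolic
change of variables `t = T + βs`, `x = x₀ + λz`, `λ² = νβ`, `v = (λ/ν) u(T+β·, x₀+λ·)`, point-gauged pressure, the tree's
`pvFrame_isClassical` / `pv_typeI_transfer` / `isBackwardBoundedAt_of_pv_bound` and ns-s29-p2's pointwise annular pressure bound
`annularPressureBoundS30_holds` — with the one covariance line now `∇v(s)(z) = (λ²/ν) ∇u(t)(x)` (chain rule, `fderiv_stPull`) and
the linearity of `L`: `‖z₁‖² ‖L(∇v(s)(z))‖ = ‖x₁ − x₀‖² ‖L(∇u(t)(x))‖/ν`.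

Width-seat file (prover ns-imp-p1 g4, S-door lane, DIRECTOR-NS #209 (2) / #210 (3); planner of record nsreg-p1 g25),
`--supports stmt-NavierStokesRegularity-0056 --as helper`.  HONEST FRAMING: routine support plate of a corollary SCHEMA of the S31
regularity CRITERION about HYPOTHETICAL one-point Type-I blow-up profiles; 0056 `NoTypeII` / NS regularity NOT proved.
-/

noncomputable section

set_option linter.dupNamespace false

namespace Summit.NavierStokesRegularity.NavierStokesRegularity.Theorems.QuietScarPocketDoor

open MeasureTheory Set Function Filter Topology TopologicalSpace Metric
open scoped Topology
open Literature.Analysis Literature.Analysis.FluidPDE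
open Summit.NavierStokesRegularity.NavierStokesRegularity.Theorems.ScalingDefectPeepholeDoor
  (AnnularPressureBoundS30 annularPressureBoundS30_holds)
open Summit.NavierStokesRegularity.NavierStokesRegularity.Theorems.PeepholeVorticityDoor
  (pvFrame_isClassical pv_typeI_transfer isBackwardBoundedAt_of_pv_bound)

variable {F : Type*} [NormedAddCommGroup F] [NormedSpace ℝ F]

/-- **PT-L reduction: `AnnularPressureBoundS30 → FrameTransferL L`** (PT `frameTransferS31_of_annularPressure` VERBATIM with the
pocket quantity `‖L (∇·)‖`, covariant under the parabolic change of variables by the chain rule and the linearity of `L`).  `C_u = |M|/ν + 1`; the PV-frame door's `ε` serves as the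
physical `ε` (the pocket datum `‖x₁−x₀‖²‖ω‖/ν` is dimensionless); class pressure level `C_p` and scale `β` from the text; physical
pocket threshold `r₁ = λ · r₁^{PV}(C_p)`, `λ = √(νβ)`. -/
theorem frameTransferL_of_annularPressure (L : (EuclideanSpace ℝ (Fin 3) →L[ℝ] EuclideanSpace ℝ (Fin 3)) →L[ℝ] F)
    (hP : AnnularPressureBoundS30) : FrameTransferL L := by
  intro h ν hν M κ hκ hκ1
  set Cu : ℝ := |M| / ν + 1 with hCu_def
  have hCu : 0 < Cu := by positivity
  have hMCu : M / ν ≤ Cu := by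
    have h1 : M / ν ≤ |M| / ν := div_le_div_of_nonneg_right (le_abs_self M) hν.le
    linarith
  obtain ⟨ε, hε, Hd⟩ := h Cu hCu κ hκ hκ1
  refine ⟨ε, hε, fun T ρ E₀ hT hρ => ?_⟩
  obtain ⟨Cp, hCp, β, hβ, hβT, hβρ, hlamρ, HP⟩ := hP ν hν M T ρ E₀ hT hρ
  set lam : ℝ := Real.sqrt (ν * β) with hlam_def
  have hlam : 0 < lam := Real.sqrt_pos.2 (by positivity)
  have hlam2 : lam ^ 2 = ν * β := Real.sq_sqrt (by positivity)
  obtain ⟨r₁, hr₁, Hs⟩ := Hd Cp hCp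
  refine ⟨lam * r₁, by positivity, ?_⟩
  intro u p hsol hLH hdec hE x₀ hM hpocket
  obtain ⟨x₁, hx₁0, hx₁r, hquiet⟩ := hpocket
  obtain ⟨xg, hxg⟩ := HP u p hsol hLH hdec hE x₀ hM
  set v : ℝ → EuclideanSpace ℝ (Fin 3) → EuclideanSpace ℝ (Fin 3) := (lam / ν) • stPull β lam T x₀ u with hv_def
  set q : ℝ → EuclideanSpace ℝ (Fin 3) → ℝ :=
    (lam / ν) ^ 2 • stPull β lam T x₀ (fun t x => p t x - p t xg) with hq_def
  have hreg : IsClassicalNSSolutionOnRegion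
      (Ico (-1 : ℝ) 0 ×ˢ ball (0 : EuclideanSpace ℝ (Fin 3)) 1) 1 0 v q :=
    pvFrame_isClassical hν hsol hβ hβT x₀ xg
  have hI : ∀ s ∈ Ico (-1 : ℝ) 0, ∀ z ∈ ball (0 : EuclideanSpace ℝ (Fin 3)) 1,
      ‖v s z‖ ≤ Cu / (Real.sqrt (-s) + ‖z‖) :=
    pv_typeI_transfer hν hβT hβρ hlam hlam2 hlamρ hMCu hM
  have hPq : ∀ s ∈ Ico (-1 : ℝ) 0, ∀ z : EuclideanSpace ℝ (Fin 3), 1 / 2 < ‖z‖ → ‖z‖ < 3 / 4 → |q s z| ≤ Cp := hxg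
  -- the pocket in the Pineau–Vicol frame
  set z₁ : EuclideanSpace ℝ (Fin 3) := lam⁻¹ • (x₁ - x₀) with hz₁_def
  have hz₁n : ‖z₁‖ = lam⁻¹ * ‖x₁ - x₀‖ := by
    rw [hz₁_def, norm_smul, Real.norm_of_nonneg (inv_nonneg.2 hlam.le)]
  have hz₁0 : 0 < ‖z₁‖ := by rw [hz₁n]; positivity
  have hz₁r : ‖z₁‖ ≤ r₁ := by
    rw [hz₁n, inv_mul_le_iff₀ hlam]; exact hx₁r
  have hpocket' : ∃ z₁' : EuclideanSpace ℝ (Fin 3), 0 < ‖z₁'‖ ∧ ‖z₁'‖ ≤ r₁ ∧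
      ∀ z ∈ ball z₁' (κ * ‖z₁'‖), ∀ᶠ s in 𝓝[<] (0 : ℝ), ‖z₁'‖ ^ 2 * ‖L (fderiv ℝ (v s) z)‖ ≤ ε := by
    refine ⟨z₁, hz₁0, hz₁r, fun z hz => ?_⟩
    -- the physical point `x = x₀ + λ z` lies in the physical pocket
    set x : EuclideanSpace ℝ (Fin 3) := x₀ + lam • z with hx_def
    have hx : x ∈ ball x₁ (κ * ‖x₁ - x₀‖) := by
      rw [mem_ball, dist_eq_norm] at hz ⊢
      have e : x - x₁ = lam • (z - z₁) := by
        rw [hx_def, hz₁_def, smul_sub, smul_smul, mul_inv_cancel₀ hlam.ne', one_smul]; abel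
      rw [e, norm_smul, Real.norm_of_nonneg hlam.le]
      calc lam * ‖z - z₁‖ < lam * (κ * ‖z₁‖) := mul_lt_mul_of_pos_left hz hlam
        _ = κ * ‖x₁ - x₀‖ := by rw [hz₁n]; field_simp
    have hq' := (tendsto_time_affine_nhdsLT (T := T) hβ).eventually (hquiet x hx)
    filter_upwards [hq'] with s hs
    -- covariance of the datum
    have hgrad : fderiv ℝ (v s) z = (lam / ν * lam) • fderiv ℝ (u (T + β * s)) (x₀ + lam • z) := by
      have h1 : v s = (lam / ν) • stPull β lam T x₀ u s := rfl
      rw [h1, fderiv_const_smul_field, Pi.smul_apply, fderiv_stPull, smul_smul]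
    have hcoef : lam / ν * lam = lam ^ 2 / ν := by ring
    rw [hgrad, map_smul, hcoef, norm_smul (lam ^ 2 / ν) (L (fderiv ℝ (u (T + β * s)) (x₀ + lam • z))),
      Real.norm_of_nonneg (by positivity : (0 : ℝ) ≤ lam ^ 2 / ν), hz₁n]
    rw [hx_def] at hs
    have hlamne : lam ≠ 0 := hlam.ne'
    calc (lam⁻¹ * ‖x₁ - x₀‖) ^ 2 * (lam ^ 2 / ν * ‖L (fderiv ℝ (u (T + β * s)) (x₀ + lam • z))‖)
        = ν⁻¹ * (‖x₁ - x₀‖ ^ 2 * ‖L (fderiv ℝ (u (T + β * s)) (x₀ + lam • z))‖) := by field_simp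
      _ ≤ ν⁻¹ * (ν * ε) := mul_le_mul_of_nonneg_left hs (inv_nonneg.2 hν.le)
      _ = ε := by field_simp
  obtain ⟨ϱ, hϱ, B, hB⟩ := Hs v q hreg hI hPq hpocket'
  exact isBackwardBoundedAt_of_pv_bound hν hβ hlam hϱ hB

/-- **PLATE (P3) PT-L, universe-polymorphic: the frame transfer `FrameTransferL L` for every constraint `L`** (through
ns-s29-p2's pointwise annular pressure bound). -/
theorem frameTransferL_holds_of_constraint
    (L : (EuclideanSpace ℝ (Fin 3) →L[ℝ] EuclideanSpace ℝ (Fin 3)) →L[ℝ] F) : FrameTransferL L :=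
  frameTransferL_of_annularPressure L annularPressureBoundS30_holds

/-- **PLATE (P3) PT-L `frameTransferL_holds : ∀ F L, FrameTransferL L`** (the shape consumed by `targetLPocket_of` and the
instance closers). -/
theorem frameTransferL_holds : ∀ (F : Type) [NormedAddCommGroup F] [NormedSpace ℝ F]
    (L : (EuclideanSpace ℝ (Fin 3) →L[ℝ] EuclideanSpace ℝ (Fin 3)) →L[ℝ] F), FrameTransferL L :=
  fun _ _ _ L => frameTransferL_holds_of_constraint L

end Summit.NavierStokesRegularity.NavierStokesRegularity.Theorems.QuietScarPocketDoor

end
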